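import Summits.Ventures.LatticeQCDFlow.Scaling.BooleanStarDoeblinHotCoupling
import Summits.Ventures.LatticeQCDFlow.Scaling.BooleanStarColdStartLaw

/-!
HONEST FRAMING: exact (Metropolis-corrected) sampling algorithms for lattice gauge theory; figures
of merit are autocorrelation/cost numbers at stated couplings and volumes; no continuum-physics
claim.

# BooleanStarDoeblinHotLaw — THE COLD-START LAW OF THE BOOLEAN STAR WITH A DOEBLIN HOT SAMPLER `M_0 = a'·μ_0 + (1−a')·R`:
# `E Φ' ≤ (1−λ)Φ` WITH `λ = min{(1−θ)act/m, (a'hθ − (1−θ)t)/(K+θ)}`, `d(n) ≤ ((θ+K)/θ)(1−λ)ⁿ`, AND AT `θ = 2t/(2t+a'h)`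
# `t_mix(ε) ≤ ⌈((2t+a'h)/(t·a'h))·max{m/(ac), K+1}·log((1 + K(2t+a'h)/(2t))/ε)⌉` — THE REFRESH BUDGET SLOWED BY `a'`, NOTHING ELSE
# (lean-2 GEN-30, ours)

Venture-side (OURS).  Cell `lqcd-flow` (pub-lqcd), unit `pub-lqcd-lean-2-g30`, 2026-08-28.  Chapter P (OPEN-MATH-chapterM item 1 on
the two-point family), file 9.  Setting of `Scaling/BooleanStarDoeblinHotCoupling` (P8: hot kernel `M_0(u,v) = a'·μ_0(v) + (1−a')·R(u,v)`,
the adapted synchronous coupling) with the potential and the entry table of `Scaling/BooleanStarDisagreementPotential` (P2) and the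
entry/update bookkeeping of `Scaling/BooleanStarDisagreementDrift` (P3).  Only the hub update changes: a hub disagreement dies with
probability `a'` (the common fresh draw) instead of `1`.

## What is proved

* §1 **`syncDoeblinUpdate_sum_potential_le`** — the update part at level `k` is `≤ Φ − 𝟙{k=0}·a'θ·𝟙{x_0 ≠ y_0}`.
* §2 **`boolSyncDoeblin_step_potential_le`** — `Σ_b Q(a,b)Φ(b) ≤ (1−λ)Φ(a)`, **`λ = min{(1−θ)act/m, ((1−t)w_0·a'·θ − (1−θ)t)/(K+θ)}`**
  (`0 < θ ≤ 1`, `(1−θ)t ≤ (1−t)w_0a'θ`, `a ≥ 0`, multiplicities `≥ c`).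
* §3 **`boolStarDoeblin_worstTvDist_le`** — `d(n) ≤ ((θ+K)/θ)·(1−λ)ⁿ` (`μ_k`-reversible kernels, `w` a probability vector);
  **`boolStarDoeblin_worstTvDist_le_tuned`** — `θ = 2t/(2t+a'h)`, `h = (1−t)w_0`:
  **`d(n) ≤ (1 + K(2t+a'h)/(2t))·(1 − (t·a'h/(2t+a'h))·min{ac/m, 1/(K+1)})ⁿ`**;
  **`boolStarDoeblin_mixingTime_le`** — `t_mix(ε) ≤ ⌈ρ⁻¹·log((1 + K(2t+a'h)/(2t))/ε)⌉`, `ρ = (t·a'h/(2t+a'h))·min{ac/m, 1/(K+1)}`.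

Reading (no numerics implied): for the realistic hot sampler (an independence proposal from the flow with importance weights `≤ 1/a'`) the
two-point cold-start law keeps its form with the refresh budget `h` discounted to `a'h` — the same substitution `w_0 ↦ a'·w_0` as in every
chapter-M/N ceiling (`Scaling/DoeblinHotSampler`, `Scaling/DoeblinHotRegimeFree`), now for the volume-free distance profile.  NOT CLAIMED:
general `S`; anything measured.  Literature grade (cell rule): OWN; nothing cited as a fact; no new bib keys.
-/

noncomputable section

open Finset Function
open Literature.Probability.MarkovChains

namespace Summit.Ventures.LatticeQCDFlow.Scaling

variable {K m : ℕ} {μ : Fin (K + 1) → Bool → ℝ} {M : Fin (K + 1) → Bool → Bool → ℝ} {R : Bool → Bool → ℝ} {w : Fin (K + 1) → ℝ}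
  {t a' : ℝ}

section Doeblin
variable (κ : Fin m → Fin K)

/-! ## §1 The update part of the expected potential -/

/-- **The adapted update at level `k` lowers the expected potential by `a'θ` at a disagreeing hub and never raises it** (`a' ≤ 1`,
`M_k`, `R` row-stochastic, `Σ μ_0 = 1`, `θ ≥ 0`). [ours] -/
theorem syncDoeblinUpdate_sum_potential_le (hM : ∀ k, IsRowStochastic (M k)) (hR : IsRowStochastic R)
    (hμ01 : ∑ v, μ 0 v = 1) (ha'1 : a' ≤ 1) {θ : ℝ} (hθ0 : 0 ≤ θ)
    {Φ : (Fin (K + 1) → Bool) × (Fin (K + 1) → Bool) → ℝ}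
    (hΦ : ∀ a, Φ a = ∑ k : Fin (K + 1), (if k = 0 then θ else 1) * (if a.1 k = a.2 k then (0 : ℝ) else 1))
    (k : Fin (K + 1)) (x y : Fin (K + 1) → Bool) :
    ∑ b : (Fin (K + 1) → Bool) × (Fin (K + 1) → Bool),
        (if k = 0 then
            (a' * ∑ v : Bool, μ 0 v * (if b.1 = update x 0 v ∧ b.2 = update y 0 v then (1 : ℝ) else 0)
              + (1 - a') * (if x 0 = y 0 then
                  ∑ v : Bool, R (x 0) v * (if b.1 = update x 0 v ∧ b.2 = update y 0 v then (1 : ℝ) else 0)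
                else coordKernel (fun _ : Fin (K + 1) => R) 0 x b.1 * coordKernel (fun _ : Fin (K + 1) => R) 0 y b.2))
          else
            (if x k = y k then
                ∑ v : Bool, M k (x k) v * (if b.1 = update x k v ∧ b.2 = update y k v then (1 : ℝ) else 0)
              else coordKernel M k x b.1 * coordKernel M k y b.2)) * Φ b
      ≤ Φ (x, y) - (if k = 0 then a' * θ * (if x 0 = y 0 then (0 : ℝ) else 1) else 0) := by
  have hΦ0 : ∀ b, 0 ≤ Φ b := potential_nonneg hθ0 hΦ
  -- the three elementary moves through the locality of `Φ`
  have hcommon : ∀ (j : Fin (K + 1)) (v : Bool), Φ (update x j v, update y j v)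
      = Φ (x, y) - (if j = 0 then θ else 1) * (if x j = y j then (0 : ℝ) else 1) := by
    intro j v
    have hloc := potential_local_single hΦ j (x := x) (y := y) (x' := update x j v) (y' := update y j v)
      fun i hi => ⟨update_of_ne hi _ _, update_of_ne hi _ _⟩
    rw [update_self, update_self, if_pos rfl] at hloc
    rw [hloc]; ring
  have hprod : ∀ (j : Fin (K + 1)) (u v : Bool), x j ≠ y j → Φ (update x j u, update y j v) ≤ Φ (x, y) := by
    intro j u v hj
    have hloc := potential_local_single hΦ j (x := x) (y := y) (x' := update x j u) (y' := update y j v)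
      fun i hi => ⟨update_of_ne hi _ _, update_of_ne hi _ _⟩
    rw [update_self, update_self, if_neg hj] at hloc
    rw [hloc]
    have : 0 ≤ (if j = 0 then θ else (1 : ℝ)) := by split_ifs <;> linarith
    have h2 : (if u = v then (0 : ℝ) else 1) - 1 ≤ 0 := by split_ifs <;> norm_num
    nlinarith
  -- a product move at a disagreeing level `j` with kernel family `N`
  have hprodSum : ∀ (N : Fin (K + 1) → Bool → Bool → ℝ), (∀ j, IsRowStochastic (N j)) → ∀ j : Fin (K + 1), x j ≠ y j →
      ∑ b : (Fin (K + 1) → Bool) × (Fin (K + 1) → Bool), coordKernel N j x b.1 * coordKernel N j y b.2 * Φ b ≤ Φ (x, y) := by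
    intro N hN j hj
    rw [Fintype.sum_prod_type]
    simp_rw [mul_assoc, ← Finset.mul_sum]
    rw [sum_coordKernel_mul N j x (fun u => ∑ b2, coordKernel N j y b2 * Φ (u, b2))]
    rw [Finset.sum_congr rfl fun u _ => by rw [sum_coordKernel_mul N j y (fun v => Φ (update x j u, v))]]
    calc ∑ u, N j (x j) u * ∑ v, N j (y j) v * Φ (update x j u, update y j v)
        ≤ ∑ u, N j (x j) u * ∑ v, N j (y j) v * Φ (x, y) :=
          sum_le_sum fun u _ => mul_le_mul_of_nonneg_left
            (sum_le_sum fun v _ => mul_le_mul_of_nonneg_left (hprod j u v hj) ((hN j).1 _ _)) ((hN j).1 _ _)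
      _ = Φ (x, y) := by rw [← Finset.sum_mul, (hN j).2, one_mul, ← Finset.sum_mul, (hN j).2, one_mul]
  -- a common move at level `j` with row `ν` (a probability vector)
  have hcommonSum : ∀ (j : Fin (K + 1)) (ν : Bool → ℝ), (∑ v, ν v = 1) →
      ∑ b : (Fin (K + 1) → Bool) × (Fin (K + 1) → Bool),
          (∑ v : Bool, ν v * (if b.1 = update x j v ∧ b.2 = update y j v then (1 : ℝ) else 0)) * Φ b
        = Φ (x, y) - (if j = 0 then θ else 1) * (if x j = y j then (0 : ℝ) else 1) := by
    intro j ν hν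
    rw [sum_mixture_mul]
    simp_rw [sum_ite_and_mul, hcommon j]
    rw [← Finset.sum_mul, hν, one_mul]
  by_cases hk : k = 0
  · subst hk
    simp only [if_true]
    simp_rw [add_mul, Finset.sum_add_distrib, mul_assoc, ← Finset.mul_sum]
    rw [hcommonSum 0 (μ 0) hμ01, if_pos rfl]
    by_cases h0 : x 0 = y 0
    · simp only [h0, if_true]
      rw [hcommonSum 0 (R (y 0)) (hR.2 _), if_pos rfl]
      simp only [h0, if_true, mul_zero, sub_zero]
      linarith
    · simp only [h0, if_false]
      have hp := hprodSum (fun _ : Fin (K + 1) => R) (fun _ => hR) 0 h0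
      simp_rw [mul_assoc] at hp ⊢
      have := mul_le_mul_of_nonneg_left hp (sub_nonneg.mpr ha'1)
      nlinarith [this]
  · simp only [hk, if_false]
    rw [sub_zero]
    by_cases hj : x k = y k
    · simp only [hj, if_true]
      have := hcommonSum k (M k (y k)) ((hM k).2 _)
      rw [if_neg hk, hj, if_pos rfl, mul_zero, sub_zero] at this
      exact this.le
    · simp only [hj, if_false]
      have hp := hprodSum M hM k hj
      simp_rw [mul_assoc] at hp ⊢
      exact hp

/-! ## §2 The one-step contraction -/

/-- **THE ONE-STEP CONTRACTION WITH A DOEBLIN HOT SAMPLER:** `Σ_b Q(a,b)Φ(b) ≤ (1 − λ)Φ(a)`,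
**`λ = min{(1−θ)·a·c·t/m, ((1−t)w_0·a'·θ − (1−θ)t)/(K+θ)}`** (`0 < θ ≤ 1`, `(1−θ)t ≤ (1−t)w_0a'θ`, `a ≥ 0`, `a' ≤ 1`). [ours] -/
theorem boolSyncDoeblin_step_potential_le (hm : 1 ≤ m) (ht0 : 0 ≤ t) (ht1 : t ≤ 1) (hw0 : ∀ k, 0 ≤ w k) (hw1 : ∑ k, w k = 1)
    (hμ : ∀ k x, 0 < μ k x) (hμ1 : ∀ k, ∑ u, μ k u = 1) (hM : ∀ k, IsRowStochastic (M k)) (hR : IsRowStochastic R)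
    (ha'1 : a' ≤ 1) {θ a : ℝ} (hθ0 : 0 < θ) (hθ1 : θ ≤ 1) (ha0 : 0 ≤ a)
    (hreg : (1 - θ) * t ≤ (1 - t) * w 0 * a' * θ)
    {c : ℕ} (hc : ∀ p' : Fin K, c ≤ (univ.filter (fun r : Fin m => κ r = p')).card)
    {α : Fin m → (Fin (K + 1) → Bool) → ℝ}
    (hα : ∀ r z, α r z = min 1 (tensorFun μ (edgeFlowSwap (Equiv.refl Bool) 0 (κ r).succ z) / tensorFun μ z))
    (ha : ∀ r z, z 0 ≠ z (κ r).succ → a ≤ α r z)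
    {Φ : (Fin (K + 1) → Bool) × (Fin (K + 1) → Bool) → ℝ}
    (hΦ : ∀ a, Φ a = ∑ k : Fin (K + 1), (if k = 0 then θ else 1) * (if a.1 k = a.2 k then (0 : ℝ) else 1))
    {Q : (Fin (K + 1) → Bool) × (Fin (K + 1) → Bool) → (Fin (K + 1) → Bool) × (Fin (K + 1) → Bool) → ℝ}
    (hQ : ∀ a b, Q a b =
      ∑ r : Fin m, t / m *
        (min (α r a.1) (α r a.2) * (if b.1 = edgeFlowSwap (Equiv.refl Bool) 0 (κ r).succ a.1
              ∧ b.2 = edgeFlowSwap (Equiv.refl Bool) 0 (κ r).succ a.2 then (1 : ℝ) else 0)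
          + (α r a.1 - min (α r a.1) (α r a.2)) * (if b.1 = edgeFlowSwap (Equiv.refl Bool) 0 (κ r).succ a.1 ∧ b.2 = a.2
              then (1 : ℝ) else 0)
          + (α r a.2 - min (α r a.1) (α r a.2)) * (if b.1 = a.1 ∧ b.2 = edgeFlowSwap (Equiv.refl Bool) 0 (κ r).succ a.2
              then (1 : ℝ) else 0)
          + (1 - α r a.1 - α r a.2 + min (α r a.1) (α r a.2)) * (if b.1 = a.1 ∧ b.2 = a.2 then (1 : ℝ) else 0))
      + (1 - t) * ∑ k : Fin (K + 1), w k *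
        (if k = 0 then
            (a' * ∑ v : Bool, μ 0 v * (if b.1 = update a.1 0 v ∧ b.2 = update a.2 0 v then (1 : ℝ) else 0)
              + (1 - a') * (if a.1 0 = a.2 0 then
                  ∑ v : Bool, R (a.1 0) v * (if b.1 = update a.1 0 v ∧ b.2 = update a.2 0 v then (1 : ℝ) else 0)
                else coordKernel (fun _ : Fin (K + 1) => R) 0 a.1 b.1 * coordKernel (fun _ : Fin (K + 1) => R) 0 a.2 b.2))
          else
            (if a.1 k = a.2 k then
                ∑ v : Bool, M k (a.1 k) v * (if b.1 = update a.1 k v ∧ b.2 = update a.2 k v then (1 : ℝ) else 0)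
              else coordKernel M k a.1 b.1 * coordKernel M k a.2 b.2)))
    (a₀ : (Fin (K + 1) → Bool) × (Fin (K + 1) → Bool)) :
    ∑ b, Q a₀ b * Φ b
      ≤ (1 - min ((1 - θ) * a * c * t / m) (((1 - t) * w 0 * a' * θ - (1 - θ) * t) / (K + θ))) * Φ a₀ := by
  obtain ⟨x, y⟩ := a₀
  have hmpos : (0 : ℝ) < m := Nat.cast_pos.mpr (by omega)
  have hΦ0 := potential_nonneg hθ0.le hΦ (x, y)
  have hΦK := potential_le hθ0.le hΦ x y
  have hhub := potential_eq_hub_add_cold hΦ x y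
  set lam := min ((1 - θ) * a * c * t / m) (((1 - t) * w 0 * a' * θ - (1 - θ) * t) / (K + θ)) with hlam
  have hlam0 : 0 ≤ lam := le_min (by positivity) (div_nonneg (by linarith) (by positivity))
  set Sw : Fin m → ℝ := fun r =>
      min (α r x) (α r y) * Φ (edgeFlowSwap (Equiv.refl Bool) 0 (κ r).succ x, edgeFlowSwap (Equiv.refl Bool) 0 (κ r).succ y)
        + (α r x - min (α r x) (α r y)) * Φ (edgeFlowSwap (Equiv.refl Bool) 0 (κ r).succ x, y)
        + (α r y - min (α r x) (α r y)) * Φ (x, edgeFlowSwap (Equiv.refl Bool) 0 (κ r).succ y)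
        + (1 - α r x - α r y + min (α r x) (α r y)) * Φ (x, y) with hSw
  set Up : Fin (K + 1) → ℝ := fun k => ∑ b : (Fin (K + 1) → Bool) × (Fin (K + 1) → Bool),
      (if k = 0 then
          (a' * ∑ v : Bool, μ 0 v * (if b.1 = update x 0 v ∧ b.2 = update y 0 v then (1 : ℝ) else 0)
            + (1 - a') * (if x 0 = y 0 then
                ∑ v : Bool, R (x 0) v * (if b.1 = update x 0 v ∧ b.2 = update y 0 v then (1 : ℝ) else 0)
              else coordKernel (fun _ : Fin (K + 1) => R) 0 x b.1 * coordKernel (fun _ : Fin (K + 1) => R) 0 y b.2))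
        else
          (if x k = y k then
              ∑ v : Bool, M k (x k) v * (if b.1 = update x k v ∧ b.2 = update y k v then (1 : ℝ) else 0)
            else coordKernel M k x b.1 * coordKernel M k y b.2)) * Φ b with hUp
  have hexp : ∑ b, Q (x, y) b * Φ b = ∑ r : Fin m, t / m * Sw r + ∑ k : Fin (K + 1), ((1 - t) * w k) * Up k := by
    have hsplit : ∑ b, Q (x, y) b * Φ b
        = ∑ b : (Fin (K + 1) → Bool) × (Fin (K + 1) → Bool), (∑ r : Fin m, t / m *
            (min (α r x) (α r y) * (if b.1 = edgeFlowSwap (Equiv.refl Bool) 0 (κ r).succ x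
                  ∧ b.2 = edgeFlowSwap (Equiv.refl Bool) 0 (κ r).succ y then (1 : ℝ) else 0)
              + (α r x - min (α r x) (α r y)) * (if b.1 = edgeFlowSwap (Equiv.refl Bool) 0 (κ r).succ x ∧ b.2 = y
                  then (1 : ℝ) else 0)
              + (α r y - min (α r x) (α r y)) * (if b.1 = x ∧ b.2 = edgeFlowSwap (Equiv.refl Bool) 0 (κ r).succ y
                  then (1 : ℝ) else 0)
              + (1 - α r x - α r y + min (α r x) (α r y)) * (if b.1 = x ∧ b.2 = y then (1 : ℝ) else 0))) * Φ b
          + ∑ b : (Fin (K + 1) → Bool) × (Fin (K + 1) → Bool), (∑ k : Fin (K + 1), ((1 - t) * w k) *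
            (if k = 0 then
                (a' * ∑ v : Bool, μ 0 v * (if b.1 = update x 0 v ∧ b.2 = update y 0 v then (1 : ℝ) else 0)
                  + (1 - a') * (if x 0 = y 0 then
                      ∑ v : Bool, R (x 0) v * (if b.1 = update x 0 v ∧ b.2 = update y 0 v then (1 : ℝ) else 0)
                    else coordKernel (fun _ : Fin (K + 1) => R) 0 x b.1 * coordKernel (fun _ : Fin (K + 1) => R) 0 y b.2))
              else
                (if x k = y k then
                    ∑ v : Bool, M k (x k) v * (if b.1 = update x k v ∧ b.2 = update y k v then (1 : ℝ) else 0)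
                  else coordKernel M k x b.1 * coordKernel M k y b.2))) * Φ b := by
      rw [← Finset.sum_add_distrib]
      refine sum_congr rfl fun b _ => ?_
      rw [hQ, ← add_mul]
      congr 2
      rw [Finset.mul_sum]
      exact sum_congr rfl fun k _ => by ring
    rw [hsplit, sum_mixture_mul, sum_mixture_mul]
    congr 1
    exact sum_congr rfl fun r _ => by rw [syncSwap_sum_potential]
  rw [hexp]
  have hswap : ∀ r : Fin m, Sw r ≤ Φ (x, y) + (if x 0 = y 0
      then -((1 - θ) * a * (if x (κ r).succ = y (κ r).succ then (0 : ℝ) else 1))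
      else (1 - θ) * (if x (κ r).succ = y (κ r).succ then (1 : ℝ) else 0)) :=
    fun r => syncSwap_potential_le κ hμ hθ0.le hθ1 hα ha hΦ r x y
  have hupd : ∀ k : Fin (K + 1), Up k ≤ Φ (x, y) - (if k = 0 then a' * θ * (if x 0 = y 0 then (0 : ℝ) else 1) else 0) :=
    fun k => syncDoeblinUpdate_sum_potential_le hM hR (hμ1 0) ha'1 hθ0.le hΦ k x y
  have h2 : ∑ k : Fin (K + 1), ((1 - t) * w k) * Up k
      ≤ (1 - t) * Φ (x, y) - (1 - t) * w 0 * a' * θ * (if x 0 = y 0 then (0 : ℝ) else 1) := by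
    calc ∑ k : Fin (K + 1), ((1 - t) * w k) * Up k
        ≤ ∑ k : Fin (K + 1), ((1 - t) * w k) * (Φ (x, y) - (if k = 0 then a' * θ * (if x 0 = y 0 then (0 : ℝ) else 1) else 0)) :=
          sum_le_sum fun k _ => mul_le_mul_of_nonneg_left (hupd k) (mul_nonneg (by linarith) (hw0 k))
      _ = (1 - t) * Φ (x, y) - (1 - t) * w 0 * a' * θ * (if x 0 = y 0 then (0 : ℝ) else 1) := by
          simp_rw [mul_sub, Finset.sum_sub_distrib]
          rw [show ∑ k : Fin (K + 1), (1 - t) * w k * Φ (x, y) = (1 - t) * Φ (x, y) by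
            rw [← Finset.sum_mul, ← Finset.mul_sum, hw1, mul_one]]
          rw [Finset.sum_eq_single (0 : Fin (K + 1)) (fun k _ hk => by rw [if_neg hk, mul_zero])
            (fun h => absurd (mem_univ _) h), if_pos rfl]
          ring
  have htsum : ∑ _r : Fin m, t / m * Φ (x, y) = t * Φ (x, y) := by
    rw [sum_const, card_univ, Fintype.card_fin, nsmul_eq_mul]; field_simp
  by_cases h0 : x 0 = y 0
  · rw [if_pos h0, mul_zero, sub_zero] at h2
    rw [if_pos h0, mul_zero, zero_add] at hhub
    have hcnt := sum_entries_disagree_ge κ hc x y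
    have h1 : ∑ r : Fin m, t / m * Sw r
        ≤ t * Φ (x, y) - t / m * ((1 - θ) * a) * ∑ r : Fin m, (if x (κ r).succ = y (κ r).succ then (0 : ℝ) else 1) := by
      calc ∑ r : Fin m, t / m * Sw r
          ≤ ∑ r : Fin m, (t / m * Φ (x, y) - t / m * ((1 - θ) * a) * (if x (κ r).succ = y (κ r).succ then (0 : ℝ) else 1)) :=
            sum_le_sum fun r _ => by
              have h := hswap r
              rw [if_pos h0] at h
              have := mul_le_mul_of_nonneg_left h (show (0 : ℝ) ≤ t / m by positivity)
              linarith
        _ = t * Φ (x, y) - t / m * ((1 - θ) * a) * ∑ r : Fin m, (if x (κ r).succ = y (κ r).succ then (0 : ℝ) else 1) := by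
            rw [Finset.sum_sub_distrib, htsum, ← Finset.mul_sum]
    have hD : (1 - θ) * a * c * t / m * Φ (x, y)
        ≤ t / m * ((1 - θ) * a) * ∑ r : Fin m, (if x (κ r).succ = y (κ r).succ then (0 : ℝ) else 1) := by
      have h := mul_le_mul_of_nonneg_left hcnt (show (0 : ℝ) ≤ (1 - θ) * a * (t / m) by positivity)
      calc (1 - θ) * a * c * t / m * Φ (x, y) = (1 - θ) * a * (t / m) * (c * Φ (x, y)) := by ring
        _ = (1 - θ) * a * (t / m) * (c * ∑ j : Fin K, (if x j.succ = y j.succ then (0 : ℝ) else 1)) := by rw [← hhub]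
        _ ≤ (1 - θ) * a * (t / m) * ∑ r : Fin m, (if x (κ r).succ = y (κ r).succ then (0 : ℝ) else 1) := h
        _ = t / m * ((1 - θ) * a) * ∑ r : Fin m, (if x (κ r).succ = y (κ r).succ then (0 : ℝ) else 1) := by ring
    have hmin : lam ≤ (1 - θ) * a * c * t / m := min_le_left _ _
    have hlamΦ : lam * Φ (x, y) ≤ (1 - θ) * a * c * t / m * Φ (x, y) := mul_le_mul_of_nonneg_right hmin hΦ0
    linarith [h1, h2, hD, hlamΦ]
  · rw [if_neg h0, mul_one] at h2
    have h1 : ∑ r : Fin m, t / m * Sw r ≤ t * Φ (x, y) + t * (1 - θ) := by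
      calc ∑ r : Fin m, t / m * Sw r ≤ ∑ _r : Fin m, (t / m * Φ (x, y) + t / m * (1 - θ)) :=
            sum_le_sum fun r _ => by
              have h := hswap r
              rw [if_neg h0] at h
              have hb : (1 - θ) * (if x (κ r).succ = y (κ r).succ then (1 : ℝ) else 0) ≤ 1 - θ := by
                split_ifs
                · rw [mul_one]
                · rw [mul_zero]; linarith
              have := mul_le_mul_of_nonneg_left (h.trans (by linarith [hb] : Φ (x, y) + (1 - θ)
                * (if x (κ r).succ = y (κ r).succ then (1 : ℝ) else 0) ≤ Φ (x, y) + (1 - θ)))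
                (show (0 : ℝ) ≤ t / m by positivity)
              linarith
        _ = t * Φ (x, y) + t * (1 - θ) := by
            rw [Finset.sum_add_distrib, htsum, sum_const, card_univ, Fintype.card_fin, nsmul_eq_mul]
            field_simp
    have hmin : lam ≤ ((1 - t) * w 0 * a' * θ - (1 - θ) * t) / (K + θ) := min_le_right _ _
    have hKθ : (0 : ℝ) < K + θ := by positivity
    have hlamK : lam * Φ (x, y) ≤ (1 - t) * w 0 * a' * θ - (1 - θ) * t := by
      calc lam * Φ (x, y) ≤ lam * (θ + K) := mul_le_mul_of_nonneg_left hΦK hlam0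
        _ ≤ ((1 - t) * w 0 * a' * θ - (1 - θ) * t) / (K + θ) * (θ + K) := mul_le_mul_of_nonneg_right hmin (by positivity)
        _ = (1 - t) * w 0 * a' * θ - (1 - θ) * t := by field_simp; ring
    linarith [h1, h2, hlamK]

end Doeblin

end Summit.Ventures.LatticeQCDFlow.Scaling

end
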